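import Summits.AtomisticToContinuum.BoseEinsteinCondensation.Theses.BECThomsonPrinciple

/-!
# Crux `GDTransfer` (stmt-AtomisticToContinuum-9482) — strategist workfile: the seeded-continuity split

Seat `planner-cstrat-stmt-AtomisticToContinuum-9482-p1-0` (crux-strategist, wall-breaker), 2026-08-17.
Companion of `STRATEGY-CENSUS.md` (same directory). This file TYPES the three leaf sub-cruxes of the
decomposition as `def … : Prop` (bodies = verbatim the `statement` fields of `children.json` handed to
`ledger route edit --split GDTransfer`), proves the glue `gdTransfer_of_subs` and the exactness facts, and
records (docstrings) the proof plan of the provable child `SoftSeededTransfer`. The importable copy of the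
glue, with the three statements INLINED (so that `--glue-by` type-matches the gate's generated decls by
δ-unfolding — checked in the seat's `work/GlueByTest.lean`, rc 0), is
`Theorems/BECThomsonPrincipleGDTransferSplit.lean`. Nothing open is asserted; 0 sorries.

## Why this split (one paragraph; details in the census)
Every variational use of `GaussianDominationCan` (global LNSS source `Λ_k = n̂₀^{-1/2}a₀†a_k`) at a
near-minimiser yields at most the ALL-OR-NOTHING law `E[(n₀/N)(1−n₀/N)] ≤ o_ρ(1) + 4πa/M²` (three dead
lines + a1/a2 + census §T.3–T.4): GD empties the middle band of the `n̂₀`-law but is blind to the totally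
depleted branch. GD is however UNIFORM in `(N, L)`: at fixed `N` the band is empty on the whole path
`L ∈ [(N/ρ)^{1/3}, L_max]`, `L_max = M²N/4π²` (the window holds the lowest mode iff `L ≤ L_max`), and at
`L_max` Dyson's bound + kinetic Chebyshev give complete condensation for free. The unique Perron–Frobenius
ground state moves continuously in `L`; the ONLY way its `n̂₀`-law can get from "condensed" (corner) to
"depleted" without populating the empty band is a balanced macroscopic superposition at an avoided
crossing. `NoBalancedCat` (C₁) forbids exactly that and nothing more; `SoftSeededTransfer` (C₂) is the
resulting theorem for integrable `v`; `HardCoreSeededTransfer` (C₃) is its non-integrable twin.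
-/

noncomputable section

namespace Summit.AtomisticToContinuum.BoseEinsteinCondensation.Cruxes.GDTransfer.SeededContinuity

open Summit.AtomisticToContinuum.BoseEinsteinCondensation.Theses.BECThomsonPrinciple
open MeasureTheory

/-- **C₁ — the seed `NoBalancedCat`.** For every admissible `v` and band parameters `0 < θ`, `0 < β`,
`θ + β < 1` there are `τ ∈ (0, 1/2)`, `ρ₀ > 0`, `N₀` such that for `N = m+1 ≥ N₀`, every `L > 0` with
`N ≤ ρ₀L³` and `E₀^per(N,L) < ∞`, some slack `δ > 0` makes every `δ`-near-minimiser `Ψ` of the periodic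
energy satisfy: NOT (`P_Ψ(n̂₀ < θN) ≥ τ` AND `P_Ψ(n̂₀ ≥ (1−β)N) ≥ τ`). Here `P_Ψ(n̂₀ = j) = Σ_{|S|=j} ∫|Q_SΨ|²`
with the crux's own `Q_S = Π_{i∈S}P_iΠ_{i∉S}(1−P_i)` (definitionally `Negative.modeProj`). The weakest seed
that closes the intermediate-value argument of C₂ (any `τ < 1/2` suffices); logically independent of
`PeriodicBEC` (the identically depleted law satisfies it; `E[n̂₀] ≥ cN` does not imply it); GD-equivalent to
distributional BEC along the path (census §D.1), so presumably deep. Nearest prior art: the exponential law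
of `N₊` in the Gross–Pitaevskii regime (Nam–Rademacher, arXiv:2307.10622, Cor. 1.2) — i.e. C₁ holds at the
corner of the path; open in the thermodynamic window. -/
def NoBalancedCat : Prop :=
  open Literature.MathematicalPhysics.QuantumManyBody.BoseGas in (∀ v : ℝ → ENNReal, IsRepulsiveFiniteRange v → ∀ θ β : ℝ, 0 < θ → 0 < β → θ + β < 1 → ∃ τ : ℝ, 0 < τ ∧ τ < 1 / 2 ∧ ∃ ρ₀ : ℝ, 0 < ρ₀ ∧ ∃ N₀ : ℕ, ∀ m : ℕ, N₀ ≤ m + 1 → ∀ L : ℝ, 0 < L → ((m + 1 : ℕ) : ℝ) ≤ ρ₀ * L ^ 3 → periodicGroundStateEnergy v (m + 1) L ≠ ⊤ → ∃ δ : ENNReal, 0 < δ ∧ ∀ Ψ : PeriodicTrialState (m + 1) L, periodicEnergy v Ψ ≤ periodicGroundStateEnergy v (m + 1) L + δ → let P : Fin (m + 1) → (Config (m + 1) → ℂ) → (Config (m + 1) → ℂ) := fun i g X => ((L ^ 3)⁻¹ : ℝ) • ∫ y in cell L, g (Function.update X i y); let Q : Finset (Fin (m + 1)) → (Config (m + 1)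 → ℂ) → (Config (m + 1) → ℂ) := fun S g => (List.finRange (m + 1)).foldr (fun i h => if i ∈ S then P i h else h - P i h) g; let w : Finset (Fin (m + 1)) → ENNReal := fun S => ∫⁻ X in cellN (m + 1) L, (‖Q S Ψ.ψ X‖₊ : ENNReal) ^ 2; ¬ (ENNReal.ofReal τ ≤ ∑ S ∈ (Finset.univ : Finset (Finset (Fin (m + 1)))).filter (fun S => (S.card : ℝ) < θ * (m + 1)), w S ∧ ENNReal.ofReal τ ≤ ∑ S ∈ (Finset.univ : Finset (Finset (Fin (m + 1)))).filter (fun S => (1 - β) * (m + 1) ≤ (S.card : ℝ)), w S))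

/-- **C₂ — `SoftSeededTransfer`**: `GaussianDominationCan → NoBalancedCat → PeriodicBEC` for integrable `v`.
PLAN (stubs a crux-plan seat would register; sizes are guesses):
* `stub_projectedDichotomy` [L; the one new analytic stub]: GD ⇒ at `δ`-near-minimisers, uniformly for
  `N ≥ N₀`, `N ≤ ρ₀L³`, `E₀ ≠ ⊤`: `P(θN ≤ n̂₀ < (1−β)N) ≤ (K√(N/L³) + 4πa(1+o(1))/M²)/β` — a0's sector-projected
  LNSS pair `𝟙(n̂₀ ≥ m)Λ†Ψ`, `𝟙(n̂₀ ≥ m)ΛΨ` with the cut `m` averaged over `[θN/2, θN]` (boundary layers of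
  `[V, 𝟙(n̂₀ ≥ m)]` weigh `≤ C/N`), second variation intensive inside the projection, zero defect, number
  identity `‖𝟙ΛΨ‖² = E[n̂_k; n̂₀ ≥ m+1]`; then the LANDED `windowLaw` + `modeCounting` bookkeeping
  (Theorems/BECThomsonPrincipleGDTransfer{ChordVariation,LnssAlgebra,BareAdmissible,WindowLaw,ModeCounting}).
* `stub_freeCorner` [M; provable now]: at `L = M²N/4π²`, `E[N − n̂₀] ≤ E₀L²/4π² ≤ 4πa(1+o(1))N/M²`
  (`LSSY2005_upperBound_periodic_holds`, kinetic Chebyshev, cell Parseval); window/side relation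
  `Negative.side_le_of_inWindow`.
* `stub_groundStateContinuity` [L]: for integrable `v`, fixed `N`: the periodic ground state is unique,
  positive, is the `L²`-limit of every minimising sequence of `C¹` trial states, and (scaled to the unit
  torus) is `L²`-continuous in `L`; hence `L ↦ P_{Ψ₀(N,L)}(n̂₀ ∈ A)` is continuous for every `A ⊆ ℕ`
  (Perron–Frobenius/Feynman–Kac files of `Literature/…/Periodic*`; norm-resolvent continuity from
  `‖v(L·) − v(L'·)‖_{3/2} → 0` for bounded `v`; form-singular `v` via `v ∧ n` at fixed `L`).
* `stub_ivtGlue` [M]: `F(L) := P(n̂₀ ≥ (1−β)N)` continuous on `[(N/ρ)^{1/3}, L_max]`, never in the open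
  interval `(τ, 1−τ−η)` (dichotomy gives band `≤ η < 1 − 2τ`; the seed gives `P(lo) < τ ∨ P(hi) < τ`),
  `F(L_max) > τ` ⇒ `F > 1 − τ − η` everywhere ⇒ `E_{Ψ₀}[n̂₀] ≥ (1−β)(1−τ−η)N` at `L = sideLength ρ N`.
* `stub_nearMinimiserTransfer` [M]: at fixed `(N, L)` the gap `E₁ − E₀ > 0` turns the ground-state bound
  into the `∃ δ ∀ Ψ` form of `PeriodicBEC` with `c = (1−β)(1−τ−η)/2` (`CondensateOccupationStability`
  pattern). Constants: `θ = β = 1/8` → `(τ, ρ₀¹, N₀¹)` seed → `η₀ = (1−2τ)/4` → `M` → `(ρ₀², C, N₀²)` GD →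
  `K` → `ρ₀`. -/
def SoftSeededTransfer : Prop :=
  open Literature.MathematicalPhysics.QuantumManyBody.BoseGas in (GaussianDominationCan → NoBalancedCat → ∀ v : ℝ → ENNReal, IsRepulsiveFiniteRange v → (∫⁻ x : Space, v ‖x‖) ≠ ⊤ → ∃ ρ₀ : ℝ, 0 < ρ₀ ∧ ∀ ρ : ℝ, 0 < ρ → ρ < ρ₀ → ∃ c : ℝ, 0 < c ∧ ∀ᶠ N : ℕ in Filter.atTop, ∃ δ : ENNReal, 0 < δ ∧ ∀ Ψ : PeriodicTrialState N (sideLength ρ N), periodicEnergy v Ψ ≤ periodicGroundStateEnergy v N (sideLength ρ N) + δ → ENNReal.ofReal (c * N) ≤ condensateOccupation N (sideLength ρ N) Ψ.ψ)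

/-- **C₃ — `HardCoreSeededTransfer`**: the non-integrable regime (hard cores), given GD, the seed and the
soft conclusion. Mechanism on record: (a) INHERITED GD at fixed `(N, L, s, k)` —
`E₀(H_{v∧n} + s(Λ+Λ†)) ↑ E₀(H_v + s(Λ+Λ†))` (monotone convergence of closed forms; the source is bounded), so
the truncations inherit `v`'s constants up to `o_n(1)` although `GaussianDominationCan`'s constants are
existential per potential; (b) Dyson-dressed sector-projected LNSS witnesses (the moved flat particle must be
dressed: its Born cost `ρ‖v∧n‖₁` diverges) — a0's `dwf_of_relativeDefect` (p93820) and `ANALYSIS.md`: the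
first-order dressing defect is a weighted static structure factor of `Ψ₀`; (c) the continuity/corner/IVT/gap
steps of C₂ for hard-core forms (Mosco continuity in `L`; Dyson's bound holds for hard cores; Perron–Frobenius
on the connected hard-sphere configuration space at low density). The soft conclusion is kept as a hypothesis
so that a comparison theorem (hard ⇐ soft) may also close it. -/
def HardCoreSeededTransfer : Prop :=
  open Literature.MathematicalPhysics.QuantumManyBody.BoseGas in (GaussianDominationCan → NoBalancedCat → (∀ v : ℝ → ENNReal, IsRepulsiveFiniteRange v → (∫⁻ x : Space, v ‖x‖) ≠ ⊤ → ∃ ρ₀ : ℝ, 0 < ρ₀ ∧ ∀ ρ : ℝ, 0 < ρ → ρ < ρ₀ → ∃ c : ℝ, 0 < c ∧ ∀ᶠ N : ℕ in Filter.atTop, ∃ δ : ENNReal, 0 < δ ∧ ∀ Ψ : PeriodicTrialState N (sideLength ρ N), periodicEnergy v Ψ ≤ periodicGroundStateEnergy v N (sideLength ρ N) + δ → ENNReal.ofReal (c * N) ≤ condensateOccupation N (sideLength ρ N) Ψ.ψ) → ∀ v : ℝ → ENNReal, IsRepulsiveFiniteRange v → ∃ ρ₀ : ℝ, 0 < ρ₀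 ∧ ∀ ρ : ℝ, 0 < ρ → ρ < ρ₀ → ∃ c : ℝ, 0 < c ∧ ∀ᶠ N : ℕ in Filter.atTop, ∃ δ : ENNReal, 0 < δ ∧ ∀ Ψ : PeriodicTrialState N (sideLength ρ N), periodicEnergy v Ψ ≤ periodicGroundStateEnergy v N (sideLength ρ N) + δ → ENNReal.ofReal (c * N) ≤ condensateOccupation N (sideLength ρ N) Ψ.ψ)

/-- **Glue**: the three children give the crux BY NAME. -/
theorem gdTransfer_of_subs :
    NoBalancedCat → SoftSeededTransfer → HardCoreSeededTransfer → GDTransfer :=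
  fun h₁ h₂ h₃ hG => h₃ hG h₁ (h₂ hG h₁)

/-- C₂ is a weakening of the crux (implied by it; the seed is not used). -/
theorem softSeededTransfer_of_gdTransfer (h : GDTransfer) : SoftSeededTransfer :=
  fun hG _ v hv _ => h hG v hv

/-- C₃ is a weakening of the crux (implied by it). -/
theorem hardCoreSeededTransfer_of_gdTransfer (h : GDTransfer) : HardCoreSeededTransfer :=
  fun hG _ _ v hv => h hG v hv

/-- Exactness modulo the seed: given C₁ the crux is equivalent to C₂ ∧ C₃. -/
theorem gdTransfer_iff_children_given_seed (h₁ : NoBalancedCat) :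
    GDTransfer ↔ SoftSeededTransfer ∧ HardCoreSeededTransfer :=
  ⟨fun h => ⟨softSeededTransfer_of_gdTransfer h, hardCoreSeededTransfer_of_gdTransfer h⟩,
   fun h => gdTransfer_of_subs h₁ h.1 h.2⟩

/-- The seed is NOT a Markov costume of the consequent: it is satisfied by any law with no mass on the
condensed side — abstractly, `¬(τ ≤ p ∧ τ ≤ q)` holds whenever `q < τ`, whatever `p` is. (The content of
"the identically depleted law satisfies C₁"; the quantitative use is `stub_ivtGlue`.) -/
theorem seed_shape_of_hi_lt {τ p q : ENNReal} (hq : q < τ) : ¬ (τ ≤ p ∧ τ ≤ q) :=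
  fun h => absurd h.2 (not_le.mpr hq)

/-- The IVT core of `stub_ivtGlue`, abstractly: a continuous `F : [a, b] → ℝ` that avoids the open interval
`(lo, hi)` (`lo < hi`) and ends above `lo` at `b` is `≥ hi` on all of `[a, b]`. -/
theorem ivt_core {a b lo hi : ℝ} (hab : a ≤ b) (hlh : lo < hi) {F : ℝ → ℝ}
    (hF : ContinuousOn F (Set.Icc a b)) (havoid : ∀ x ∈ Set.Icc a b, F x ≤ lo ∨ hi ≤ F x)
    (hend : lo < F b) : ∀ x ∈ Set.Icc a b, hi ≤ F x := by
  intro x hx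
  rcases havoid x hx with hxlo | hxhi
  · exfalso
    -- F b ≥ hi (it is > lo and avoids the gap); F x ≤ lo; IVT on [x, b] gives a value in (lo, hi).
    have hb : b ∈ Set.Icc a b := ⟨hab, le_rfl⟩
    have hFb : hi ≤ F b := (havoid b hb).resolve_left (not_le.mpr hend)
    set m : ℝ := (lo + hi) / 2 with hm
    have hm1 : lo < m := by rw [hm]; linarith
    have hm2 : m < hi := by rw [hm]; linarith
    have hxb : x ≤ b := hx.2
    have hsub : Set.Icc x b ⊆ Set.Icc a b := Set.Icc_subset_Icc hx.1 le_rfl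
    have hcont : ContinuousOn F (Set.Icc x b) := hF.mono hsub
    have hmem : m ∈ Set.Icc (F x) (F b) := ⟨by linarith, by linarith⟩
    obtain ⟨c, hc, hFc⟩ := intermediate_value_Icc hxb hcont hmem
    rcases havoid c (hsub hc) with h1 | h2
    · linarith
    · linarith
  · exact hxhi

end Summit.AtomisticToContinuum.BoseEinsteinCondensation.Cruxes.GDTransfer.SeededContinuity

end
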